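/-
Copyright (c) 2026 the pub-hodgecm-mathlib formalisation cell (harness21).  Prover seat hodgecm-mathlib-LH4-p14 (g2), req620 Track A «(D-RAM) FOUR-FRAME» squad
(unit U3_Laws, MS ROAD A Stage A₂ «RE-KEY tv = 2 ON MULTIPLICITY»; brick (O2b)-MULT dealt by LH4-p11 (g2)'s RULING 2026-09-04T00:53:03Z (3) under the heir LEAD's
RULING (R-21); Stage B lead LH4-p10 (g2); dealer LH4-plan (g11)).  2026-09-04.
-/
import Summits.HodgeConjecture.HodgeConjecture.Theorems.F0P3cDyRamDiagonalOrbitFibreCountMultHead   -- (O2b)-MULT M2 (this seat): the head over a system of representatives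
import Summits.HodgeConjecture.HodgeConjecture.Theorems.F0P3cDyRamDiagonalOrbitFibreCountHeads      -- ★ (O2b) PART 4 (this seat): `finite_unitTorus_orbit_of_mem_normalisedStableLattices`
import Summits.HodgeConjecture.HodgeConjecture.Theorems.F0P3cDyRamDiagonalPolarisationCoset        -- ★ LH4-p11 (g2): `isVertexLattice_diagonal_mul_of_mem_fixedUnitStabilizer`
import Literature.NumberTheory.Automorphic.UnitaryLatticeTreeIsTree          -- ★ `exists_scaleLattice_pow_stdLattice_le_latt`
import Literature.NumberTheory.Automorphic.UnitaryLatticeTreeTypeTwoGram     -- ★ `isIntMatrix_mul`, `isIntMatrix_transpose_map`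
import Literature.NumberTheory.Automorphic.UnitaryLatticeTreeSelfDualFrames  -- ★ `scaleLattice_stdLattice_eq_latt_diagonal`
import Literature.NumberTheory.Automorphic.UnitaryLatticeTreeDual            -- ★ `latt_le_stdLattice_iff`, `latt_le_latt_iff`
import Mathlib.Tactic.FieldSimp
import HarnessLib

/-!
# Crux `H413`, line LH4 «(D-RAM) FOUR-FRAME» road — unit U3_Laws (iii), MS ROAD A Stage A₂, brick (O2b)-MULT FILE M3: THE HEADS IN COSET-COUNT CURRENCY —
# `(Σ_{M ∈ 𝒯·M₀} #fibre_tv(M)) · [𝒰 : S_F(M₀)] = 8 · [𝒯 : S̃(M₀)] · #(Δ_tv(M₀) ∕ S_F(M₀))` at every `M₀ ∈ 𝓛₀(T)`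

Cell `hodgecm-mathlib` (D-0151), FLOOR 0, crux item H413 = `stmt-HodgeConjecture-24833`, route of record `HCCMUnconditional`; squad F0∕P3c∕LH4 (req618∕req620).  THEOREMS ONLY
(no `def`, no instance, no notation, no `sorry`); lane `--supports stmt-HodgeConjecture-24833 --as helper` (count-neutral).

M2 proved the fibre identity with multiplicity over ANY finite system `reps` of `S_F(M₀)`-coset representatives of the type-`tv` polarisations.  Here the multiplicity is the COSET
COUNT itself: with `𝒞_tv(M₀) := {D·S_F(M₀) : D σ-fixed non-degenerate, M₀ type-tv for diag D}` (the set LH4-p11 (g2)'s ★ StrataDefs ED. 3 names `polarisationCosets σ ϖ tv M₀`, written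
out here so that this file does not wait on the definition review; `polarisationCount σ ϖ tv M₀ = (𝒞_tv(M₀)).ncard` is `rfl`),
  `(Σᶠ_{M ∈ 𝒯·M₀} #fibre_tv(M)) · [𝒰 : S_F(M₀)] = 8 · [𝒯 : S̃(M₀)] · #𝒞_tv(M₀)`   for every `M₀ ∈ 𝓛₀(T)`
(`T = diag(s)`, `s` pairwise-distinct units, finite residue field) — EXACTLY the `hO2b`∕`hmult` binder of ★ (O2c) ED. 2
`…DiagonalOrbitAveraging.sum_ncard_fixed_vertices_eq_eight_mul_finsum_mul_stabiliserWeight_of_fibre_identity` at `m := polarisationCount σ ϖ tv`.  Two inputs beyond M2: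
* §1–§2 FINITENESS OF `𝒞_tv(M₀)` for a normalised full lattice with `[𝒰 : S_F(M₀)] < ∞`: a polarisation `D` of `M₀ = P·𝒪³ ⊇ ϖⁿ𝒪³` has `|ϖ| ≤ |D_i| ≤ |ϖ|^{−2n}` (§1: with
  `G = σ(P)ᵀ·diag(D)·P`, the integral matrices `P·(ϖG⁻¹)·σ(P)ᵀ = ϖ·diag(D)⁻¹` and `σ(C)ᵀ·G·C = σ(ϖⁿ)ϖⁿ·diag(D)`, `C = ϖⁿP⁻¹`), so in the decomposition `D = N(ϖu^{a})·w`
  (★ PART 2) the exponent `a` lies in a finite box and the class `w·S_F` in the finite `𝒰 ∕ S_F`; the coset `D·S_F` is determined by `(a, w·S_F)`;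
* §3 REPRESENTATIVES: choosing one `D_C` per coset gives `reps` with M2's `hΔ` (★ `isVertexLattice_diagonal_mul_of_mem_fixedUnitStabilizer` for the translates) and `hfree`.
HONEST LABEL.  Count-neutral (`--supports`); nothing printed is asserted; (MS) stays a PROVER TARGET; `HC_CM` is proved only modulo the 7 printed citations (2 remaining named inputs:
hLiu418 = `stmt-HodgeConjecture-24832`, h413 = `stmt-HodgeConjecture-24833`) until rung 0 closes.

## References
* [Kottwitz1986BaseChangeUnits] R. E. Kottwitz, *Base change for unit elements of Hecke algebras*, Compositio Math. 60 (1986), §1 pp. 240–241.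
* [Jacobowitz1962] R. Jacobowitz, *Hermitian forms over local fields*, Amer. J. Math. 84 (1962), §4, §7.
* [Serre1979] J.-P. Serre, *Local Fields*, GTM 67 (1979), Ch. V §3.
-/

set_option autoImplicit false

noncomputable section

namespace Summit.HodgeConjecture.HodgeConjecture.Cruxes.H413.F0P3cDyRamDiagonalOrbitFibreCountMultHeads

open Matrix
open Literature.NumberTheory.Automorphic Literature.NumberTheory.Automorphic.HermitianLattice
open Literature.NumberTheory.Automorphic.UnitaryLatticeTree
open Summit.HodgeConjecture.HodgeConjecture.Cruxes.H413.F0P3cDyRamDiagonalTorusDefs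
open Summit.HodgeConjecture.HodgeConjecture.Cruxes.H413.F0P3cDyRamDiagonalOrbitFibreTransport
open Summit.HodgeConjecture.HodgeConjecture.Cruxes.H413.F0P3cDyRamDiagonalOrbitFibreCount
open Summit.HodgeConjecture.HodgeConjecture.Cruxes.H413.F0P3cDyRamDiagonalOrbitFibreCountHeads (finite_unitTorus_orbit_of_mem_normalisedStableLattices)
open Summit.HodgeConjecture.HodgeConjecture.Cruxes.H413.F0P3cDyRamDiagonalOrbitFibreCountMultHead
open Summit.HodgeConjecture.HodgeConjecture.Cruxes.H413.F0P3cDyRamDiagonalPolarisationCoset (isVertexLattice_diagonal_mul_of_mem_fixedUnitStabilizer)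
open Summit.HodgeConjecture.HodgeConjecture.Cruxes.H413.F0P3cDyRamDiagonalOrbitAveraging (relIndex_fixedUnitStabilizer_ne_zero_of_finite)
open scoped Valued WithZero Matrix MatrixGroups

variable {K : Type*} [Field K] [Valued K ℤᵐ⁰]

/-! ## §1  A polarisation of an integral full lattice has bounded valuations -/

/-- **LOWER BOUND `|ϖ| ≤ |D_i|`.**  If `M₀ ⊆ 𝒪³` is a type-`tv` vertex lattice of `diag(D)` then every `|D_i| ≥ |ϖ|`: with `M₀ = P·𝒪³` (`P` integral) and the Gram matrix
`G = σ(P)ᵀ·diag(D)·P`, the INTEGRAL matrix `Z = P·(ϖG⁻¹)·σ(P)ᵀ` satisfies `Z·diag(D) = ϖ·1`, so `Z_ii·D_i = ϖ`. [cite: Jacobowitz1962, §4, §7] -/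
theorem v_le_v_diagonal_of_isVertexLattice {σ : K →+* K} (hvσ : ∀ a, Valued.v (σ a) = Valued.v a) {ϖ : K} (hϖ0 : ϖ ≠ 0) {D : Fin 3 → K} {tv : ℕ}
    {M₀ : Submodule 𝒪[K] (Fin 3 → K)} (hint : ∀ x ∈ M₀, ∀ i, Valued.v (x i) ≤ 1) (hV : IsVertexLattice σ ϖ (Matrix.diagonal D) tv M₀) (i : Fin 3) :
    Valued.v ϖ ≤ Valued.v (D i) := by
  obtain ⟨g, hM, hG, hG', hdet⟩ := hV
  set P : Matrix (Fin 3) (Fin 3) K := (g : Matrix (Fin 3) (Fin 3) K) with hP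
  set G : Matrix (Fin 3) (Fin 3) K := formCongr σ g (Matrix.diagonal D) with hGdef
  have hPunit : IsUnit P.det := Matrix.isUnits_det_units g
  have hPint : IsIntMatrix P := (latt_le_stdLattice_iff P).1 fun x hx => mem_stdLattice.2 fun j => hint x (hM ▸ hx) j
  have hGunit : IsUnit G.det := by
    rw [isUnit_iff_ne_zero, ← (Valued.v).ne_zero_iff, hdet]
    exact pow_ne_zero _ ((Valued.v).ne_zero_iff.2 hϖ0)
  have hZ : IsIntMatrix (P * (ϖ • G⁻¹) * (P.map σ)ᵀ) := isIntMatrix_mul (isIntMatrix_mul hPint hG') (isIntMatrix_transpose_map hvσ hPint)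
  have h1 : (P.map σ)ᵀ * Matrix.diagonal D = G * P⁻¹ := by
    rw [hGdef, formCongr, ← hP, Matrix.mul_assoc ((P.map σ)ᵀ * Matrix.diagonal D), Matrix.mul_nonsing_inv _ hPunit, Matrix.mul_one]
  have h2 : P * (ϖ • G⁻¹) * (P.map σ)ᵀ * Matrix.diagonal D = ϖ • (1 : Matrix (Fin 3) (Fin 3) K) := by
    rw [Matrix.mul_assoc (P * (ϖ • G⁻¹)), h1, Matrix.mul_smul, Matrix.smul_mul, Matrix.mul_assoc P G⁻¹, ← Matrix.mul_assoc G⁻¹,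
      Matrix.nonsing_inv_mul _ hGunit, Matrix.one_mul, Matrix.mul_nonsing_inv _ hPunit]
  have h3 := congrArg (fun A : Matrix (Fin 3) (Fin 3) K => A i i) h2
  simp only [Matrix.mul_diagonal, Matrix.smul_apply, Matrix.one_apply_eq, smul_eq_mul, mul_one] at h3
  calc Valued.v ϖ = Valued.v ((P * (ϖ • G⁻¹) * (P.map σ)ᵀ) i i) * Valued.v (D i) := by rw [← map_mul, h3]
    _ ≤ Valued.v (D i) := mul_le_of_le_one_left' (hZ i i)

/-- **UPPER BOUND `|D_i|·|ϖ|^{2n} ≤ 1`.**  If `M₀ ⊇ ϖⁿ𝒪³` is a type-`tv` vertex lattice of `diag(D)` then every `|D_i| ≤ |ϖ|^{−2n}`: with `M₀ = P·𝒪³`, `C = P⁻¹·ϖⁿ` is integral and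
`σ(C)ᵀ·G·C = diag(σ(ϖⁿ)·D_i·ϖⁿ)` is integral. [cite: Jacobowitz1962, §4, §7] -/
theorem v_diagonal_mul_le_of_isVertexLattice {σ : K →+* K} (hvσ : ∀ a, Valued.v (σ a) = Valued.v a) {ϖ : K} (hϖ0 : ϖ ≠ 0) {D : Fin 3 → K} {tv : ℕ}
    {M₀ : Submodule 𝒪[K] (Fin 3 → K)} {n : ℕ} (hn : scaleLattice (ϖ ^ n) (stdLattice K 3) ≤ M₀) (hV : IsVertexLattice σ ϖ (Matrix.diagonal D) tv M₀) (i : Fin 3) :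
    Valued.v (D i) * Valued.v ϖ ^ (2 * n) ≤ 1 := by
  obtain ⟨g, hM, hG, -, -⟩ := hV
  set P : Matrix (Fin 3) (Fin 3) K := (g : Matrix (Fin 3) (Fin 3) K) with hP
  have hPunit : IsUnit P.det := Matrix.isUnits_det_units g
  rw [hM, scaleLattice_stdLattice_eq_latt_diagonal (pow_ne_zero _ hϖ0), latt_le_latt_iff hPunit] at hn
  -- `C := P⁻¹ · ϖⁿ` is integral and `σ(C)ᵀ G C = diag(σ(ϖⁿ) D ϖⁿ)`
  set C : Matrix (Fin 3) (Fin 3) K := P⁻¹ * Matrix.diagonal fun _ : Fin 3 => ϖ ^ n with hC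
  have hW : IsIntMatrix ((C.map σ)ᵀ * formCongr σ g (Matrix.diagonal D) * C) := isIntMatrix_mul (isIntMatrix_mul (isIntMatrix_transpose_map hvσ hn) hG) hn
  have hPC : P * C = Matrix.diagonal fun _ : Fin 3 => ϖ ^ n := by rw [hC, ← Matrix.mul_assoc, Matrix.mul_nonsing_inv _ hPunit, Matrix.one_mul]
  have hPCσ : (C.map σ)ᵀ * (P.map σ)ᵀ = Matrix.diagonal fun _ : Fin 3 => σ (ϖ ^ n) := by
    rw [← Matrix.transpose_mul, ← Matrix.map_mul, hPC, Matrix.diagonal_map (map_zero σ), Matrix.diagonal_transpose]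
  have hWeq : (C.map σ)ᵀ * formCongr σ g (Matrix.diagonal D) * C = Matrix.diagonal fun j => σ (ϖ ^ n) * D j * ϖ ^ n := by
    rw [formCongr, ← hP]
    calc (C.map σ)ᵀ * ((P.map σ)ᵀ * Matrix.diagonal D * P) * C
        = ((C.map σ)ᵀ * (P.map σ)ᵀ) * Matrix.diagonal D * (P * C) := by simp only [Matrix.mul_assoc]
      _ = Matrix.diagonal fun j => σ (ϖ ^ n) * D j * ϖ ^ n := by rw [hPCσ, hPC, Matrix.diagonal_mul_diagonal, Matrix.diagonal_mul_diagonal]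
  have h := hW i i
  rw [hWeq, Matrix.diagonal_apply_eq, map_mul, map_mul, hvσ, map_pow] at h
  calc Valued.v (D i) * Valued.v ϖ ^ (2 * n) = Valued.v (D i) * (Valued.v ϖ ^ n * Valued.v ϖ ^ n) := by rw [two_mul, pow_add]
    _ = Valued.v ϖ ^ n * Valued.v (D i) * Valued.v ϖ ^ n := by rw [← mul_assoc, mul_comm (Valued.v (D i))]
    _ ≤ 1 := h


/-! ## §2  The cosets `D·S_F(M₀)`: translation invariance; finitely many for a normalised full lattice with `[𝒰 : S_F(M₀)] < ∞` -/

/-- `D₁·S_F(M₀) = D₂·S_F(M₀)` when `D₂ = D₁·u`, `u ∈ S_F(M₀)`. [cite: Kottwitz1986BaseChangeUnits, §1 pp. 240–241] -/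
theorem setOf_translate_eq_of_eq_mul (σ : K →+* K) (M₀ : Submodule 𝒪[K] (Fin 3 → K)) {D₁ D₂ : Fin 3 → K} {u : Fin 3 → Kˣ}
    (hu : u ∈ fixedUnitStabilizer σ M₀) (hDu : ∀ i, D₂ i = D₁ i * ((u i : Kˣ) : K)) :
    {D' : Fin 3 → K | ∃ v ∈ fixedUnitStabilizer σ M₀, ∀ i, D' i = D₁ i * ((v i : Kˣ) : K)} =
      {D' : Fin 3 → K | ∃ v ∈ fixedUnitStabilizer σ M₀, ∀ i, D' i = D₂ i * ((v i : Kˣ) : K)} := by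
  ext D'
  simp only [Set.mem_setOf_eq]
  constructor
  · rintro ⟨v, hv, h⟩
    refine ⟨u⁻¹ * v, (fixedUnitStabilizer σ M₀).mul_mem ((fixedUnitStabilizer σ M₀).inv_mem hu) hv, fun i => ?_⟩
    rw [h i, hDu i, Pi.mul_apply, Pi.inv_apply, Units.val_mul, Units.val_inv_eq_inv_val]
    field_simp
  · rintro ⟨v, hv, h⟩
    refine ⟨u * v, (fixedUnitStabilizer σ M₀).mul_mem hu hv, fun i => ?_⟩
    rw [h i, hDu i, Pi.mul_apply, Units.val_mul, mul_assoc]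

/-- **FINITELY MANY POLARISATION COSETS.**  For a NORMALISED full lattice `M₀ = g·𝒪³` with `[𝒰 : S_F(M₀)] ≠ 0` (e.g. a member of `𝓛₀(T)`), any type `tv`: the set of cosets
`D·S_F(M₀)` of the `σ`-fixed non-degenerate `D` with `M₀` type-`tv` for `diag D` (= ★ `polarisationCosets σ ϖ tv M₀`) is finite — `D = N(ϖu^{a})·w` (★ PART 2) with `a` in the
box `[−n, 0]³` (§1, `M₀ ⊇ ϖⁿ𝒪³`) and `w·S_F` in the finite `𝒰 ∕ S_F`, and `(a, w·S_F)` determines the coset. [cite: Kottwitz1986BaseChangeUnits, §1 pp. 240–241] [cite: Jacobowitz1962, §7] -/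
theorem finite_setOf_polarisationCosets {σ : K →+* K} (hσ : ∀ x, σ (σ x) = x) (hvσ : ∀ a, Valued.v (σ a) = Valued.v a)
    {ϖ : K} (hϖ : Valued.v ϖ = WithZero.exp (-1 : ℤ)) (ϖu : Kˣ) (hϖu : (ϖu : K) = ϖ)
    {c : K} (hσc : σ c = c) (hcv : Valued.v c = 1)
    (hdich : ∀ x : K, σ x = x → x ≠ 0 → (∃ z : K, z * σ z = x) ∨ ∃ z : K, z * σ z = c * x)
    (g : GL (Fin 3) K) {M₀ : Submodule 𝒪[K] (Fin 3 → K)} (hM₀ : M₀ = latt (g : Matrix (Fin 3) (Fin 3) K)) (hnorm : IsNormalisedLattice M₀)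
    (hSF : (fixedUnitStabilizer σ M₀).relIndex (fixedUnitTorus σ 3) ≠ 0) (tv : ℕ) :
    {C : Set (Fin 3 → K) | ∃ D : Fin 3 → K, ((∀ i, σ (D i) = D i ∧ D i ≠ 0) ∧ IsVertexLattice σ ϖ (Matrix.diagonal D) tv M₀) ∧
      C = {D' : Fin 3 → K | ∃ u ∈ fixedUnitStabilizer σ M₀, ∀ i, D' i = D i * ((u i : Kˣ) : K)}}.Finite := by
  classical
  have hϖ0 : ϖ ≠ 0 := Literature.NumberTheory.Automorphic.CartanUnique.uniformizer_ne_zero hϖ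
  obtain ⟨n, hn⟩ := exists_scaleLattice_pow_stdLattice_le_latt hϖ g
  rw [← hM₀] at hn
  have hint : ∀ x ∈ M₀, ∀ i, Valued.v (x i) ≤ 1 := fun x hx i => (hnorm i).1 x hx
  set Cos : Set (Set (Fin 3 → K)) := {C : Set (Fin 3 → K) | ∃ D : Fin 3 → K, ((∀ i, σ (D i) = D i ∧ D i ≠ 0) ∧
    IsVertexLattice σ ϖ (Matrix.diagonal D) tv M₀) ∧ C = {D' : Fin 3 → K | ∃ u ∈ fixedUnitStabilizer σ M₀, ∀ i, D' i = D i * ((u i : Kˣ) : K)}} with hCos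
  -- representatives and their decompositions `rep C = N(ϖu^{a_C})·w_C`
  have hrep : ∀ C ∈ Cos, ∃ D : Fin 3 → K, ((∀ i, σ (D i) = D i ∧ D i ≠ 0) ∧ IsVertexLattice σ ϖ (Matrix.diagonal D) tv M₀) ∧
      C = {D' : Fin 3 → K | ∃ u ∈ fixedUnitStabilizer σ M₀, ∀ i, D' i = D i * ((u i : Kˣ) : K)} := fun C hC => hC
  choose! rep hrepP hrepC using hrep
  choose! aOf wOf hwU hDw using fun (C : Set (Fin 3 → K)) (hC : C ∈ Cos) =>
    exists_zpow_fixedUnit_decomposition hσ hvσ hϖ ϖu hϖu hσc hcv hdich (rep C) (hrepP C hC).1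
  -- the exponents lie in the box `[-n, 0]³`
  have hbox : ∀ C ∈ Cos, ∀ i, -(n : ℤ) ≤ aOf C i ∧ aOf C i ≤ 0 := by
    intro C hC i
    have hwU' := (mem_fixedUnitTorus_iff σ (wOf C)).1 (hwU C hC)
    have hvD : Valued.v (rep C i) = WithZero.exp (-(2 * aOf C i)) := by
      rw [hDw C hC i, map_mul, v_unitNormMap_zpow hvσ hϖ ϖu hϖu, hwU'.1 i, mul_one]
    have hlo := v_le_v_diagonal_of_isVertexLattice hvσ hϖ0 hint (hrepP C hC).2 i
    have hhi := v_diagonal_mul_le_of_isVertexLattice hvσ hϖ0 hn (hrepP C hC).2 i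
    rw [hvD, hϖ, WithZero.exp_le_exp] at hlo
    rw [hvD, hϖ, ← WithZero.exp_nsmul, ← WithZero.exp_add, ← WithZero.exp_zero, WithZero.exp_le_exp] at hhi
    rw [nsmul_eq_mul] at hhi
    constructor <;> omega
  -- the classes `w·S_F`, `w ∈ 𝒰`, are finitely many
  have hfinQ : ((QuotientGroup.mk' (fixedUnitStabilizer σ M₀)) '' (fixedUnitTorus σ 3 : Set (Fin 3 → Kˣ))).Finite := by
    refine Set.finite_of_ncard_ne_zero ?_
    have hcard : ((QuotientGroup.mk' (fixedUnitStabilizer σ M₀)) '' (fixedUnitTorus σ 3 : Set (Fin 3 → Kˣ))).ncard =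
        (QuotientGroup.mk' (fixedUnitStabilizer σ M₀)).ker.relIndex (fixedUnitTorus σ 3) := by
      rw [Subgroup.relIndex_ker]
      exact (Nat.card_coe_set_eq _).symm
    rw [hcard, QuotientGroup.ker_mk']
    exact hSF
  -- `C ↦ (a_C, w_C·S_F)` is injective on the cosets and lands in a finite set
  have hinj : Set.InjOn (fun C : Set (Fin 3 → K) => (aOf C, QuotientGroup.mk' (fixedUnitStabilizer σ M₀) (wOf C))) Cos := by
    intro C hC C' hC' h
    obtain ⟨ha, hw⟩ := Prod.mk.inj h
    obtain ⟨z, hz, hwz⟩ := (QuotientGroup.mk'_eq_mk' (fixedUnitStabilizer σ M₀)).1 hw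
    rw [hrepC C hC, hrepC C' hC']
    refine setOf_translate_eq_of_eq_mul σ M₀ hz fun i => ?_
    rw [hDw C' hC' i, hDw C hC i, ← ha, ← hwz, Pi.mul_apply, Units.val_mul, mul_assoc]
  refine Set.Finite.of_finite_image ?_ hinj
  refine ((Set.Finite.pi' fun _ : Fin 3 => Set.finite_Icc (-(n : ℤ)) 0).prod hfinQ).subset ?_
  rintro _ ⟨C, hC, rfl⟩
  exact Set.mk_mem_prod (fun i => Set.mem_Icc.2 (hbox C hC i)) ⟨wOf C, hwU C hC, rfl⟩

/-! ## §3  HEADS — the fibre count with multiplicity = the number of polarisation cosets -/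

open Classical in
/-- **(O2b)-MULT IN COSET-COUNT CURRENCY, GENERIC.**  Under the hypotheses of M2 on `σ, ϖ, c` and for ANY `M₀` with finite unit-torus orbit whose set `𝒞_tv(M₀)` of polarisation
cosets is finite: `(Σᶠ_{M ∈ 𝒯·M₀} #fibre_tv(M)) · [𝒰 : S_F(M₀)] = 8 · [𝒯 : S̃(M₀)] · #𝒞_tv(M₀)` — M2 on a system of representatives chosen one per coset (`hΔ` by ★
`isVertexLattice_diagonal_mul_of_mem_fixedUnitStabilizer`, `hfree` by §2). [cite: Kottwitz1986BaseChangeUnits, §1 pp. 240–241] [cite: Jacobowitz1962, §7] -/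
theorem finsum_ncard_fibre_mul_relIndex_eq_mul_ncard_cosets {σ : K →+* K} (hσ : ∀ x, σ (σ x) = x) (hvσ : ∀ a, Valued.v (σ a) = Valued.v a)
    {ϖ : K} (hϖ : Valued.v ϖ = WithZero.exp (-1 : ℤ)) (ϖu : Kˣ) (hϖu : (ϖu : K) = ϖ)
    {c : K} (hσc : σ c = c) (hcv : Valued.v c = 1) (hc : ¬ ∃ z : K, z * σ z = c)
    (hdich : ∀ x : K, σ x = x → x ≠ 0 → (∃ z : K, z * σ z = x) ∨ ∃ z : K, z * σ z = c * x)
    {M₀ : Submodule 𝒪[K] (Fin 3 → K)}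
    (hfin : {M : Submodule 𝒪[K] (Fin 3 → K) | ∃ u ∈ unitTorus K 3, M = mapGL (diagGLUnits u) M₀}.Finite) (tv : ℕ)
    (hCos : {C : Set (Fin 3 → K) | ∃ D : Fin 3 → K, ((∀ i, σ (D i) = D i ∧ D i ≠ 0) ∧ IsVertexLattice σ ϖ (Matrix.diagonal D) tv M₀) ∧
      C = {D' : Fin 3 → K | ∃ u ∈ fixedUnitStabilizer σ M₀, ∀ i, D' i = D i * ((u i : Kˣ) : K)}}.Finite) :
    (∑ᶠ M ∈ {M : Submodule 𝒪[K] (Fin 3 → K) | ∃ u ∈ unitTorus K 3, M = mapGL (diagGLUnits u) M₀},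
        ({p : (Fin 3 → Bool) × (Fin 3 → ℤ) |
          IsVertexLattice σ ϖ (Matrix.diagonal fun i => if p.1 i then c else (1 : K)) tv (mapGL (diagGLUnits fun i => ϖu ^ p.2 i) M)} : Set _).ncard)
      * (fixedUnitStabilizer σ M₀).relIndex (fixedUnitTorus σ 3)
      = 8 * (unitStabilizer M₀).relIndex (unitTorus K 3) *
        {C : Set (Fin 3 → K) | ∃ D : Fin 3 → K, ((∀ i, σ (D i) = D i ∧ D i ≠ 0) ∧ IsVertexLattice σ ϖ (Matrix.diagonal D) tv M₀) ∧
          C = {D' : Fin 3 → K | ∃ u ∈ fixedUnitStabilizer σ M₀, ∀ i, D' i = D i * ((u i : Kˣ) : K)}}.ncard := by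
  classical
  set Cos : Set (Set (Fin 3 → K)) := {C : Set (Fin 3 → K) | ∃ D : Fin 3 → K, ((∀ i, σ (D i) = D i ∧ D i ≠ 0) ∧
    IsVertexLattice σ ϖ (Matrix.diagonal D) tv M₀) ∧ C = {D' : Fin 3 → K | ∃ u ∈ fixedUnitStabilizer σ M₀, ∀ i, D' i = D i * ((u i : Kˣ) : K)}} with hCosdef
  have hrep : ∀ C ∈ Cos, ∃ D : Fin 3 → K, ((∀ i, σ (D i) = D i ∧ D i ≠ 0) ∧ IsVertexLattice σ ϖ (Matrix.diagonal D) tv M₀) ∧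
      C = {D' : Fin 3 → K | ∃ u ∈ fixedUnitStabilizer σ M₀, ∀ i, D' i = D i * ((u i : Kˣ) : K)} := fun C hC => hC
  choose! rep hrepP hrepC using hrep
  have hrepinj : Set.InjOn rep Cos := fun C hC C' hC' h => by rw [hrepC C hC, hrepC C' hC', h]
  set reps : Finset (Fin 3 → K) := hCos.toFinset.image rep with hreps
  have hcard : reps.card = Cos.ncard := by
    rw [hreps, Finset.card_image_of_injOn (by rwa [Set.Finite.coe_toFinset]), Set.ncard_eq_toFinset_card _ hCos]
  have hmem : ∀ D₁ : Fin 3 → K, D₁ ∈ reps ↔ ∃ C ∈ Cos, rep C = D₁ := fun D₁ => by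
    rw [hreps, Finset.mem_image]
    simp only [Set.Finite.mem_toFinset]
  rw [← hcard]
  refine finsum_ncard_fibre_mul_relIndex_eq_mul_card hσ hvσ hϖ ϖu hϖu hσc hcv hc hdich hfin tv reps ?_ ?_ ?_
  · intro D₁ hD₁
    obtain ⟨C, hC, rfl⟩ := (hmem D₁).1 hD₁
    exact (hrepP C hC).1
  · intro D hD
    constructor
    · intro hV
      have hC : {D' : Fin 3 → K | ∃ u ∈ fixedUnitStabilizer σ M₀, ∀ i, D' i = D i * ((u i : Kˣ) : K)} ∈ Cos := ⟨D, ⟨hD, hV⟩, rfl⟩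
      have hDmem : D ∈ {D' : Fin 3 → K | ∃ u ∈ fixedUnitStabilizer σ M₀, ∀ i, D' i = D i * ((u i : Kˣ) : K)} :=
        ⟨1, Subgroup.one_mem _, fun i => by rw [Pi.one_apply, Units.val_one, mul_one]⟩
      rw [hrepC _ hC] at hDmem
      obtain ⟨u, hu, hDu⟩ := hDmem
      exact ⟨rep _, (hmem _).2 ⟨_, hC, rfl⟩, u, hu, hDu⟩
    · rintro ⟨D₁, hD₁, u, hu, hDu⟩
      obtain ⟨C, hC, rfl⟩ := (hmem D₁).1 hD₁
      have hfun : (fun i => rep C i * ((u i : Kˣ) : K)) = D := funext fun i => (hDu i).symm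
      exact hfun ▸ isVertexLattice_diagonal_mul_of_mem_fixedUnitStabilizer σ (hrepP C hC).2 hu
  · intro D₁ hD₁ D₂ hD₂ u hu hDu
    obtain ⟨C₁, hC₁, rfl⟩ := (hmem D₁).1 hD₁
    obtain ⟨C₂, hC₂, rfl⟩ := (hmem D₂).1 hD₂
    have h12 : C₁ = C₂ := by
      rw [hrepC C₁ hC₁, hrepC C₂ hC₂]
      exact setOf_translate_eq_of_eq_mul σ M₀ hu hDu
    rw [h12]

/-- **(O2b)-MULT IN `𝓛₀(T)`-CURRENCY — THE `hmult` ∕ `hO2b` BINDER OF ★ (O2c) ED. 2 AT `m = #𝒞_tv` (= `polarisationCount σ ϖ tv`).**  `T = diag(s)` with `s`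
pairwise-distinct units, finite residue field, `σ` an isometric involution, `ϖ = ↑ϖu` a uniformiser, `c` a `σ`-fixed NON-NORM unit with the (NI2) dichotomy; then at EVERY
`M₀ ∈ 𝓛₀(T)` and every type `tv`:  `(Σᶠ_{M ∈ 𝒯·M₀} #fibre_tv(M)) · [𝒰 : S_F(M₀)] = 8 · [𝒯 : S̃(M₀)] · #𝒞_tv(M₀)`.  No one-coset hypothesis, no Iverson bracket: the
multiplicity `#𝒞_tv(M₀) = #(Δ_tv(M₀)∕S_F(M₀))` is `1` on the type-0 lattices and the on-branch∕odd-`ρ` type-2 strata and `q` on the glued type-2 strata with `ρ` even (LH4-p09 (g2)).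
(Orbit finite: ★ PART 4; cosets finite: §2.) [cite: Kottwitz1986BaseChangeUnits, §1 pp. 240–241] [cite: Jacobowitz1962, §7] -/
theorem finsum_ncard_fibre_mul_relIndex_eq_mul_ncard_cosets_of_mem_normalisedStableLattices [Finite 𝓀[K]] {σ : K →+* K} (hσ : ∀ x, σ (σ x) = x)
    (hvσ : ∀ a, Valued.v (σ a) = Valued.v a) {ϖ : K} (hϖ : Valued.v ϖ = WithZero.exp (-1 : ℤ)) (ϖu : Kˣ) (hϖu : (ϖu : K) = ϖ)
    {c : K} (hσc : σ c = c) (hcv : Valued.v c = 1) (hc : ¬ ∃ z : K, z * σ z = c)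
    (hdich : ∀ x : K, σ x = x → x ≠ 0 → (∃ z : K, z * σ z = x) ∨ ∃ z : K, z * σ z = c * x)
    {s : Fin 3 → K} (hs : ∀ i, Valued.v (s i) = 1) (hreg : ∀ i j, i ≠ j → s i ≠ s j)
    (T : GL (Fin 3) K) (hT : (T : Matrix (Fin 3) (Fin 3) K) = Matrix.diagonal s)
    {M₀ : Submodule 𝒪[K] (Fin 3 → K)} (hM₀ : M₀ ∈ normalisedStableLattices T) (tv : ℕ) :
    (∑ᶠ M ∈ {M : Submodule 𝒪[K] (Fin 3 → K) | ∃ u ∈ unitTorus K 3, M = mapGL (diagGLUnits u) M₀},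
        ({p : (Fin 3 → Bool) × (Fin 3 → ℤ) |
          IsVertexLattice σ ϖ (Matrix.diagonal fun i => if p.1 i then c else (1 : K)) tv (mapGL (diagGLUnits fun i => ϖu ^ p.2 i) M)} : Set _).ncard)
      * (fixedUnitStabilizer σ M₀).relIndex (fixedUnitTorus σ 3)
      = 8 * (unitStabilizer M₀).relIndex (unitTorus K 3) *
        {C : Set (Fin 3 → K) | ∃ D : Fin 3 → K, ((∀ i, σ (D i) = D i ∧ D i ≠ 0) ∧ IsVertexLattice σ ϖ (Matrix.diagonal D) tv M₀) ∧
          C = {D' : Fin 3 → K | ∃ u ∈ fixedUnitStabilizer σ M₀, ∀ i, D' i = D i * ((u i : Kˣ) : K)}}.ncard := by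
  have hfin := finite_unitTorus_orbit_of_mem_normalisedStableLattices hϖ hs hreg T hT hM₀
  obtain ⟨⟨g, hg⟩, -, hnorm⟩ := hM₀
  exact finsum_ncard_fibre_mul_relIndex_eq_mul_ncard_cosets hσ hvσ hϖ ϖu hϖu hσc hcv hc hdich hfin tv
    (finite_setOf_polarisationCosets hσ hvσ hϖ ϖu hϖu hσc hcv hdich g hg hnorm (relIndex_fixedUnitStabilizer_ne_zero_of_finite σ hfin) tv)

end Summit.HodgeConjecture.HodgeConjecture.Cruxes.H413.F0P3cDyRamDiagonalOrbitFibreCountMultHeads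

end
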